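import Mathlib
import Summits.MatrixMultiplication.MatrixMultiplication.Theorems.LevelOneGL2Designs.Negative.LevelSpace
import Summits.MatrixMultiplication.MatrixMultiplication.Theorems.SubgroupIdentityDesigns.Negative.VectorTransportSpan

/-!
# The exact dimension bound `dim F_1|_{GL_m(𝔽_p)} ≤ 1 + a² + (p − 2) b²`
(support lemma for the crux `SubgroupIdentityDesigns`, stmt-MatrixMultiplication-14079; cell B2b-5
`b2b-lgcu-borel`, gen 11 — report `run/shared/lean/b2b/levelgraded-cu/ORACLE-g11.md` §G11-3f)

`VectorTransportSpan.levelSubmodule_le_of_generators` puts `F_1|_G` inside the span of the constant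
`1` and the transports `t_{rep ℓ, a}` indexed by
`J = {(ℓ, a) : a ≠ 0, a ≠ a₀, ¬(ℓ = ℓ₀ ∧ a = rep ℓ' for some ℓ' ≠ ℓ₀)}`.
Counting (`card_index_add`): `#J + 3b = b p^m + 1`, `b = #ℙ^{m−1}(𝔽_p) = (p^m − 1)/(p − 1)`, hence
(`finrank_levelOne_add_le`) `dim F_1|_G + 3b ≤ 2 + b p^m`, i.e. (`finrank_levelOne_le_real`)
`dim F_1|_G ≤ 2 + b (p^m − 3) = 1 + a² + (p − 2) b²`, `a = b − 1 = (p^m − p)/(p − 1)`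
— the sum of the squares of the degrees `1, a, b` of the level-one characters `1`, `Ind_P^G 1 − 1`,
`π_χ (χ ≠ 1)`; since their matrix coefficients lie in `F_1|_G` this is in fact the exact dimension
(only `≤` is proved and needed).  It replaces the count `N_1 = #{rk ≤ 1} = 1 + b (p^m − 1)` in the
wall ceiling `2V² ≤ (dim F_1)³` (`PackingBridge.crux_walls`) — see `Negative/LevelOneDimSqueeze.lean`.
Sorry-free.  VALUE = theorem (an exact constant), NOT summit progress; the crux item stays open.
-/

set_option linter.dupNamespace false

noncomputable section

open scoped BigOperators Classical Matrix LinearAlgebra.Projectivization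
open Module (finrank)

namespace Summit.MatrixMultiplication.MatrixMultiplication.Theorems.SubgroupIdentityDesigns.Negative
namespace LevelOneDim

open Summit.MatrixMultiplication.MatrixMultiplication.Theorems.LieRankDesigns.Negative (GLm Mat)
open Summit.MatrixMultiplication.MatrixMultiplication.Theorems.LevelOneGL2Designs.Negative
  (levelSubmodule)
open VectorTransportSpan (levelSubmodule_le_of_generators)

variable {p m : ℕ} [hp : Fact p.Prime]

/-- **SPAN BOUND.**  `dim F_1|_G ≤ 1 + #J` for the deleted index set `J` (any `a₀ ≠ 0`). -/
theorem finrank_levelOne_le_card {a₀ : Fin m → ZMod p} (ha₀ : a₀ ≠ 0) :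
    finrank ℂ (levelSubmodule p m 1) ≤ 1 +
      Nat.card {x : ℙ (ZMod p) (Fin m → ZMod p) × (Fin m → ZMod p) //
        x.2 ≠ 0 ∧ x.2 ≠ a₀ ∧ ¬ (x.1 = Projectivization.mk (ZMod p) a₀ ha₀ ∧
          ∃ ℓ' : ℙ (ZMod p) (Fin m → ZMod p), ℓ' ≠ Projectivization.mk (ZMod p) a₀ ha₀ ∧
            ℓ'.rep = x.2)} := by
  haveI : Fintype (ℙ (ZMod p) (Fin m → ZMod p)) := Fintype.ofFinite _
  set J := {x : ℙ (ZMod p) (Fin m → ZMod p) × (Fin m → ZMod p) //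
        x.2 ≠ 0 ∧ x.2 ≠ a₀ ∧ ¬ (x.1 = Projectivization.mk (ZMod p) a₀ ha₀ ∧
          ∃ ℓ' : ℙ (ZMod p) (Fin m → ZMod p), ℓ' ≠ Projectivization.mk (ZMod p) a₀ ha₀ ∧
            ℓ'.rep = x.2)} with hJ_def
  set v : Unit ⊕ J → (GLm p m → ℂ) := Sum.elim (fun _ _ => (1 : ℂ))
    (fun x g => if (g : Mat p m) *ᵥ x.1.1.rep = x.1.2 then (1 : ℂ) else 0) with hv_def
  have hle : levelSubmodule p m 1 ≤ Submodule.span ℂ (Set.range v) := by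
    refine levelSubmodule_le_of_generators ha₀ ?_ ?_
    · exact Submodule.subset_span ⟨Sum.inl (), rfl⟩
    · intro ℓ a ha ha0 hnot
      exact Submodule.subset_span ⟨Sum.inr ⟨(ℓ, a), ha, ha0, hnot⟩, rfl⟩
  have h1 := Submodule.finrank_mono hle
  have h2 : finrank ℂ (Submodule.span ℂ (Set.range v)) ≤ Fintype.card (Unit ⊕ J) :=
    finrank_range_le_card v
  rw [Fintype.card_sum, Fintype.card_unit, ← Nat.card_eq_fintype_card] at h2
  exact h1.trans h2

/-- **COUNT OF THE DELETED INDEX SET**: `#J + 3b = b·p^m + 1`, `b = #ℙ^{m−1}(𝔽_p)`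
(`ℙ × 𝔽_p^m` is the disjoint union of `{a = 0}` (`b`), `{a = a₀}` (`b`), the column-deleted pairs
`{(ℓ₀, rep ℓ') : ℓ' ≠ ℓ₀}` (`b − 1`) and `J`). -/
theorem card_index_add {a₀ : Fin m → ZMod p} (ha₀ : a₀ ≠ 0) :
    Nat.card {x : ℙ (ZMod p) (Fin m → ZMod p) × (Fin m → ZMod p) //
        x.2 ≠ 0 ∧ x.2 ≠ a₀ ∧ ¬ (x.1 = Projectivization.mk (ZMod p) a₀ ha₀ ∧
          ∃ ℓ' : ℙ (ZMod p) (Fin m → ZMod p), ℓ' ≠ Projectivization.mk (ZMod p) a₀ ha₀ ∧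
            ℓ'.rep = x.2)} + 3 * Nat.card (ℙ (ZMod p) (Fin m → ZMod p)) =
      Nat.card (ℙ (ZMod p) (Fin m → ZMod p)) * p ^ m + 1 := by
  haveI : Fintype (ℙ (ZMod p) (Fin m → ZMod p)) := Fintype.ofFinite _
  set ℓ₀ := Projectivization.mk (ZMod p) a₀ ha₀ with hℓ₀_def
  rw [Nat.card_eq_fintype_card, Nat.card_eq_fintype_card, Fintype.card_subtype]
  -- the three nested filters
  set s₁ := (Finset.univ : Finset (ℙ (ZMod p) (Fin m → ZMod p) × (Fin m → ZMod p))).filter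
    (fun x => x.2 ≠ 0) with hs₁_def
  set s₂ := s₁.filter (fun x => x.2 ≠ a₀) with hs₂_def
  set s₃ := s₂.filter (fun x => ¬ (x.1 = ℓ₀ ∧
      ∃ ℓ' : ℙ (ZMod p) (Fin m → ZMod p), ℓ' ≠ ℓ₀ ∧ ℓ'.rep = x.2)) with hs₃_def
  have hs₃ : (Finset.univ.filter fun x : ℙ (ZMod p) (Fin m → ZMod p) × (Fin m → ZMod p) =>
      x.2 ≠ 0 ∧ x.2 ≠ a₀ ∧ ¬ (x.1 = ℓ₀ ∧
        ∃ ℓ' : ℙ (ZMod p) (Fin m → ZMod p), ℓ' ≠ ℓ₀ ∧ ℓ'.rep = x.2)) = s₃ := by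
    rw [hs₃_def, hs₂_def, hs₁_def, Finset.filter_filter, Finset.filter_filter]
  rw [hs₃]
  -- total count
  have htot : (Finset.univ : Finset (ℙ (ZMod p) (Fin m → ZMod p) × (Fin m → ZMod p))).card =
      Fintype.card (ℙ (ZMod p) (Fin m → ZMod p)) * p ^ m := by
    rw [Finset.card_univ, Fintype.card_prod]
    simp [ZMod.card]
  -- split 1: `a = 0`
  have c₁ : (Finset.univ.filter fun x : ℙ (ZMod p) (Fin m → ZMod p) × (Fin m → ZMod p) =>
      x.2 = 0).card = Fintype.card (ℙ (ZMod p) (Fin m → ZMod p)) := by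
    have : (Finset.univ.filter fun x : ℙ (ZMod p) (Fin m → ZMod p) × (Fin m → ZMod p) =>
        x.2 = 0) = Finset.univ.map ⟨fun ℓ => (ℓ, (0 : Fin m → ZMod p)),
          fun ℓ ℓ' h => (Prod.ext_iff.mp h).1⟩ := by
      ext x
      simp only [Finset.mem_filter, Finset.mem_univ, true_and, Finset.mem_map,
        Function.Embedding.coeFn_mk]
      constructor
      · intro hx; exact ⟨x.1, Prod.ext rfl hx.symm⟩
      · rintro ⟨ℓ, rfl⟩; rfl
    rw [this, Finset.card_map, Finset.card_univ]
  have e₁ : (Finset.univ.filter fun x : ℙ (ZMod p) (Fin m → ZMod p) × (Fin m → ZMod p) =>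
      x.2 = 0).card + s₁.card = Finset.univ.card :=
    Finset.card_filter_add_card_filter_not
      (fun x : ℙ (ZMod p) (Fin m → ZMod p) × (Fin m → ZMod p) => x.2 = 0)
  rw [c₁, htot] at e₁
  -- split 2: `a = a₀`
  have c₂ : (s₁.filter fun x => x.2 = a₀).card = Fintype.card (ℙ (ZMod p) (Fin m → ZMod p)) := by
    have : (s₁.filter fun x => x.2 = a₀) = Finset.univ.map ⟨fun ℓ => (ℓ, a₀),
          fun ℓ ℓ' h => (Prod.ext_iff.mp h).1⟩ := by
      ext x
      simp only [hs₁_def, Finset.mem_filter, Finset.mem_univ, true_and, Finset.mem_map,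
        Function.Embedding.coeFn_mk]
      constructor
      · rintro ⟨-, hx⟩; exact ⟨x.1, Prod.ext rfl hx.symm⟩
      · rintro ⟨ℓ, rfl⟩; exact ⟨ha₀, rfl⟩
    rw [this, Finset.card_map, Finset.card_univ]
  have e₂ : (s₁.filter fun x => x.2 = a₀).card + s₂.card = s₁.card :=
    Finset.card_filter_add_card_filter_not
      (fun x : ℙ (ZMod p) (Fin m → ZMod p) × (Fin m → ZMod p) => x.2 = a₀)
  rw [c₂] at e₂
  -- split 3: the column-deleted pairs
  have c₃ : (s₂.filter fun x => x.1 = ℓ₀ ∧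
      ∃ ℓ' : ℙ (ZMod p) (Fin m → ZMod p), ℓ' ≠ ℓ₀ ∧ ℓ'.rep = x.2).card + 1 =
      Fintype.card (ℙ (ZMod p) (Fin m → ZMod p)) := by
    have hrep_ne : ∀ ℓ' : ℙ (ZMod p) (Fin m → ZMod p), ℓ' ≠ ℓ₀ → ℓ'.rep ≠ a₀ := by
      intro ℓ' hℓ' h
      apply hℓ'
      rw [← Projectivization.mk_rep ℓ', hℓ₀_def]
      congr 1
    have : (s₂.filter fun x => x.1 = ℓ₀ ∧
        ∃ ℓ' : ℙ (ZMod p) (Fin m → ZMod p), ℓ' ≠ ℓ₀ ∧ ℓ'.rep = x.2) =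
        (Finset.univ.erase ℓ₀).map ⟨fun ℓ' => (ℓ₀, ℓ'.rep), fun ℓ ℓ' h => by
          have h2 := (Prod.ext_iff.mp h).2
          rw [← Projectivization.mk_rep ℓ, ← Projectivization.mk_rep ℓ']
          simp only at h2
          congr 1⟩ := by
      ext x
      simp only [hs₂_def, hs₁_def, Finset.mem_filter, Finset.mem_univ, true_and, Finset.mem_map,
        Finset.mem_erase, Function.Embedding.coeFn_mk]
      constructor
      · rintro ⟨⟨-, -⟩, hx1, ℓ', hℓ', hrep⟩
        exact ⟨ℓ', ⟨hℓ', trivial⟩, Prod.ext hx1.symm hrep⟩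
      · rintro ⟨ℓ', ⟨hℓ', -⟩, rfl⟩
        exact ⟨⟨ℓ'.rep_nonzero, hrep_ne ℓ' hℓ'⟩, rfl, ℓ', hℓ', rfl⟩
    rw [this, Finset.card_map, Finset.card_erase_add_one (Finset.mem_univ _), Finset.card_univ]
  have e₃ : (s₂.filter fun x => x.1 = ℓ₀ ∧
      ∃ ℓ' : ℙ (ZMod p) (Fin m → ZMod p), ℓ' ≠ ℓ₀ ∧ ℓ'.rep = x.2).card + s₃.card = s₂.card :=
    Finset.card_filter_add_card_filter_not
      (fun x : ℙ (ZMod p) (Fin m → ZMod p) × (Fin m → ZMod p) => x.1 = ℓ₀ ∧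
        ∃ ℓ' : ℙ (ZMod p) (Fin m → ZMod p), ℓ' ≠ ℓ₀ ∧ ℓ'.rep = x.2)
  -- `b + s₁.card = b p^m`, `b + s₂.card = s₁.card`, `(b-1) + s₃.card = s₂.card`
  omega

/-- **DIMENSION BOUND (integer form)**: `dim F_1|_G + 3b ≤ 2 + b p^m` for `m ≥ 1`,
`b = #ℙ^{m−1}(𝔽_p)`. -/
theorem finrank_levelOne_add_le (hm : 1 ≤ m) :
    finrank ℂ (levelSubmodule p m 1) + 3 * Nat.card (ℙ (ZMod p) (Fin m → ZMod p)) ≤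
      2 + Nat.card (ℙ (ZMod p) (Fin m → ZMod p)) * p ^ m := by
  have ha₀ : (Pi.single (⟨0, by omega⟩ : Fin m) (1 : ZMod p) : Fin m → ZMod p) ≠ 0 := by
    intro h
    have := congr_fun h (⟨0, by omega⟩ : Fin m)
    simp at this
  have h1 := finrank_levelOne_le_card (p := p) ha₀
  have h2 := card_index_add (p := p) ha₀
  omega

/-- `b (p − 1) = p^m − 1` for `b = #ℙ^{m−1}(𝔽_p)`. -/
theorem card_proj_mul : Nat.card (ℙ (ZMod p) (Fin m → ZMod p)) * (p - 1) = p ^ m - 1 := by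
  have h := Projectivization.card (k := ZMod p) (V := Fin m → ZMod p)
  rw [Nat.card_eq_fintype_card (α := Fin m → ZMod p), Fintype.card_fun, Fintype.card_fin,
    Nat.card_eq_fintype_card (α := ZMod p), ZMod.card] at h
  exact h.symm

/-- **DIMENSION BOUND (closed form)**: for `m ≥ 1`,
`dim F_1|_{GL_m(𝔽_p)} ≤ 1 + a² + (p − 2) b²`, `a = (p^m − p)/(p − 1)`, `b = (p^m − 1)/(p − 1)`
— the sum of the squares of the degrees of the level-one characters. -/
theorem finrank_levelOne_le_real (hm : 1 ≤ m) :
    (finrank ℂ (levelSubmodule p m 1) : ℝ) ≤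
      1 + (((p : ℝ) ^ m - p) / ((p : ℝ) - 1)) ^ 2 +
        ((p : ℝ) - 2) * (((p : ℝ) ^ m - 1) / ((p : ℝ) - 1)) ^ 2 := by
  have hp2 : 2 ≤ p := hp.out.two_le
  have hp1R : (1 : ℝ) < p := by exact_mod_cast hp.out.one_lt
  have hpm1 : 1 ≤ p ^ m := Nat.one_le_pow _ _ hp.out.pos
  have hC := finrank_levelOne_add_le (p := p) hm
  have hb := card_proj_mul (p := p) (m := m)
  set b := Nat.card (ℙ (ZMod p) (Fin m → ZMod p)) with hb_def
  have hCR : (finrank ℂ (levelSubmodule p m 1) : ℝ) + 3 * (b : ℝ) ≤ 2 + (b : ℝ) * (p : ℝ) ^ m := by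
    exact_mod_cast hC
  have hbR : (b : ℝ) * ((p : ℝ) - 1) = (p : ℝ) ^ m - 1 := by
    have h1 : ((b * (p - 1) : ℕ) : ℝ) = ((p ^ m - 1 : ℕ) : ℝ) := by rw [hb]
    push_cast [Nat.cast_sub (by omega : 1 ≤ p), Nat.cast_sub hpm1] at h1
    exact h1
  have hne : (p : ℝ) - 1 ≠ 0 := ne_of_gt (sub_pos.mpr hp1R)
  have hbR' : (b : ℝ) = ((p : ℝ) ^ m - 1) / ((p : ℝ) - 1) := by
    rw [eq_div_iff hne, hbR]
  have key : 2 + (b : ℝ) * (p : ℝ) ^ m - 3 * (b : ℝ) =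
      1 + (((p : ℝ) ^ m - p) / ((p : ℝ) - 1)) ^ 2 +
        ((p : ℝ) - 2) * (((p : ℝ) ^ m - 1) / ((p : ℝ) - 1)) ^ 2 := by
    rw [hbR']
    field_simp
    ring
  linarith

end LevelOneDim
end Summit.MatrixMultiplication.MatrixMultiplication.Theorems.SubgroupIdentityDesigns.Negative
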